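import Summits.NavierStokesRegularity.TurbBounds.FSU1.Corner
import Summits.NavierStokesRegularity.TurbBounds.FSU1.Mode.M03Defs

/-!
# FS-U1″ mode lemma — Scalar (`TurbBounds/FSU1/Mode/M15Scalar.lean`)

Scalar lemmas (`g₊ ≤ Ḡ`, `ε₁` monotonicity, `sinh` comparisons, `e^{−k}k^{9/5}`), facts about `R4 = √1000` and `y = Ra^{1/12}`, corner monotonicity.

Cell-made mathematics of FS-PROOF-DRAFT §3 (pub-turb-sos), kernel-checked; generated from the design compose file
`StageF_compose.check.lean` (96c4b9bf…) by `build_mode_split.py`.  HONEST FRAMING: rigorous bounds for the stated PDE and boundary conditions; no claim about physical turbulence beyond the bound.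
-/

open Real intervalIntegral MeasureTheory Set

namespace Summit.NavierStokesRegularity.TurbBounds.FSU1.Mode

open Summit.NavierStokesRegularity.TurbBounds.SpectralFormFreeSlip
open Summit.NavierStokesRegularity.TurbBounds.FSU1

/-! ## A.5 Scalar lemmas: `g₊`, `ε₁`, `sinh`, exponential monotonicity -/

/-- `g₊(k) ≤ max 0 (2e^{−k}(k−1))`. -/
theorem gplus_le_max {k : ℝ} : gplus k ≤ max 0 (2 * Real.exp (-k) * (k - 1)) := by
  unfold gplus
  have hE := Real.exp_pos (-k)
  have hden : 0 < (1 + Real.exp (-k)) ^ 2 := by positivity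
  by_cases h : k - 1 - Real.exp (-k) ≤ 0
  · refine le_trans ?_ (le_max_left _ _)
    apply div_nonpos_of_nonpos_of_nonneg _ hden.le
    nlinarith
  · push Not at h
    refine le_trans ?_ (le_max_right _ _)
    rw [div_le_iff₀ hden]
    have h1 : (1:ℝ) ≤ (1 + Real.exp (-k)) ^ 2 := by nlinarith
    nlinarith [mul_le_mul_of_nonneg_left h1 (by nlinarith : (0:ℝ) ≤ 2 * Real.exp (-k) * (k - 1))]

/-- `g₊(k) ≤ Ḡ(k)` (the tabulated majorant `Gbar`). -/
theorem gplus_le_Gbar' {k : ℝ} : gplus k ≤ Gbar k := by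
  refine le_trans gplus_le_max ?_
  unfold Gbar
  have hE := Real.exp_pos (-k)
  split_ifs with h
  · exact max_le (by nlinarith) le_rfl
  · push Not at h
    refine max_le (by positivity) ?_
    -- `e^{-k}(k-1) ≤ e^{-2}` for `k < 2`: `(k-1) ≤ e^{k-2}`
    have h1 : k - 1 ≤ Real.exp (k - 2) := by linarith [Real.add_one_le_exp (k - 2)]
    have hex : Real.exp (-2) = Real.exp (-k) * Real.exp (k - 2) := by rw [← Real.exp_add]; congr 1; ring
    rw [hex]
    nlinarith [mul_le_mul_of_nonneg_left h1 hE.le]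

/-- `g₊(k) ≤ Ḡ(k₀)` for `k ≥ k₀`. -/
theorem gplus_le_Gbar {k₀ k : ℝ} (hk : k₀ ≤ k) : gplus k ≤ Gbar k₀ :=
  le_trans gplus_le_Gbar' (Gbar_antitone hk)

/-- `g₊(k) ≤ 2k e^{-k}` (corner form). -/
theorem gplus_le_lin {k : ℝ} (hk : 0 < k) : gplus k ≤ 2 * k * Real.exp (-k) := by
  unfold gplus
  have hE := Real.exp_pos (-k)
  have hden : 0 < (1 + Real.exp (-k)) ^ 2 := by positivity
  rw [div_le_iff₀ hden]
  have h1 : (1:ℝ) ≤ (1 + Real.exp (-k)) ^ 2 := by nlinarith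
  nlinarith [mul_le_mul_of_nonneg_left h1 (by positivity : (0:ℝ) ≤ 2 * k * Real.exp (-k))]

/-- `(e^{-P}+e^{-Q})/sinh P ≤ 2e^{-Q₀}/sinh P₀` for `P ≥ P₀ > 0`, `P ≥ Q ≥ Q₀`. -/
theorem eps1_le_of {P Q P₀ Q₀ : ℝ} (hP₀ : 0 < P₀) (hP : P₀ ≤ P) (hQ : Q₀ ≤ Q) (hQP : Q ≤ P) :
    (Real.exp (-P) + Real.exp (-Q)) / Real.sinh P ≤ 2 * Real.exp (-Q₀) / Real.sinh P₀ := by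
  have hsP₀ : 0 < Real.sinh P₀ := Real.sinh_pos_iff.mpr hP₀
  have hsP : Real.sinh P₀ ≤ Real.sinh P := Real.sinh_le_sinh.mpr hP
  have hsPpos : 0 < Real.sinh P := lt_of_lt_of_le hsP₀ hsP
  have h1 : Real.exp (-P) ≤ Real.exp (-Q₀) := Real.exp_le_exp.mpr (by linarith)
  have h2 : Real.exp (-Q) ≤ Real.exp (-Q₀) := Real.exp_le_exp.mpr (by linarith)
  calc (Real.exp (-P) + Real.exp (-Q)) / Real.sinh P
      ≤ (2 * Real.exp (-Q₀)) / Real.sinh P := by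
        apply div_le_div_of_nonneg_right _ hsPpos.le; linarith
    _ ≤ 2 * Real.exp (-Q₀) / Real.sinh P₀ :=
        div_le_div_of_nonneg_left (by positivity) hsP₀ hsP

/-- Corner form: `(e^{-P}+e^{-Q})/sinh P ≤ 2/sinh k` for `P ≥ k > 0`, `Q ≥ 0`. -/
theorem eps1_le_edge {P Q k : ℝ} (hk : 0 < k) (hP : k ≤ P) (hQ : 0 ≤ Q) :
    (Real.exp (-P) + Real.exp (-Q)) / Real.sinh P ≤ 2 / Real.sinh k := by
  have hsk : 0 < Real.sinh k := Real.sinh_pos_iff.mpr hk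
  have hsP : Real.sinh k ≤ Real.sinh P := Real.sinh_le_sinh.mpr hP
  have hsPpos : 0 < Real.sinh P := lt_of_lt_of_le hsk hsP
  have h1 : Real.exp (-P) ≤ 1 := by rw [← Real.exp_zero]; exact Real.exp_le_exp.mpr (by linarith)
  have h2 : Real.exp (-Q) ≤ 1 := by rw [← Real.exp_zero]; exact Real.exp_le_exp.mpr (by linarith)
  calc (Real.exp (-P) + Real.exp (-Q)) / Real.sinh P ≤ 2 / Real.sinh P := by
        apply div_le_div_of_nonneg_right _ hsPpos.le; linarith
    _ ≤ 2 / Real.sinh k := div_le_div_of_nonneg_left (by norm_num) hsk hsP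

/-- `x ↦ sinh x / x` is non-decreasing: `b·sinh a ≤ a·sinh b` for `0 < a ≤ b`. -/
theorem mul_sinh_le {a b : ℝ} (ha : 0 < a) (hab : a ≤ b) : b * Real.sinh a ≤ a * Real.sinh b := by
  have hb : 0 < b := lt_of_lt_of_le ha hab
  -- `sinh x ≤ x·cosh x` for `x ≥ 0`, inlined (the stand-alone lemma exists verbatim elsewhere in the tree; dedup policy 120 (C))
  have hsc : ∀ x : ℝ, 0 ≤ x → Real.sinh x ≤ x * Real.cosh x := by
    intro x hx
    have hg : ∀ t, HasDerivAt (fun t => t * Real.cosh t - Real.sinh t) (t * Real.sinh t) t := by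
      intro t
      have h := ((hasDerivAt_id' (x := t)).mul (Real.hasDerivAt_cosh t)).sub (Real.hasDerivAt_sinh t)
      refine h.congr_deriv ?_
      ring
    have hmono : MonotoneOn (fun t => t * Real.cosh t - Real.sinh t) (Ici 0) := by
      apply monotoneOn_of_deriv_nonneg (convex_Ici 0)
      · exact (HasDerivAt.continuousOn fun t _ => hg t)
      · exact fun t _ => (hg t).differentiableAt.differentiableWithinAt
      · intro t ht
        rw [interior_Ici] at ht
        have ht' : 0 < t := Set.mem_Ioi.mp ht
        rw [(hg t).deriv]
        exact mul_nonneg ht'.le (Real.sinh_nonneg_iff.mpr ht'.le)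
    have := hmono (Set.self_mem_Ici) (Set.mem_Ici.mpr hx) hx
    simp only [Real.cosh_zero, Real.sinh_zero, zero_mul, sub_zero] at this
    linarith
  have hf : ∀ t, t ≠ 0 →
      HasDerivAt (fun t => Real.sinh t / t) ((t * Real.cosh t - Real.sinh t) / t ^ 2) t := by
    intro t ht
    have h := (Real.hasDerivAt_sinh t).div (hasDerivAt_id' (x := t)) ht
    refine h.congr_deriv ?_
    ring
  have hmono : MonotoneOn (fun t => Real.sinh t / t) (Ici a) := by
    apply monotoneOn_of_deriv_nonneg (convex_Ici a)
    · exact HasDerivAt.continuousOn fun t ht => hf t (ne_of_gt (lt_of_lt_of_le ha (Set.mem_Ici.mp ht)))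
    · intro t ht
      rw [interior_Ici] at ht
      exact (hf t (ne_of_gt (lt_trans ha (Set.mem_Ioi.mp ht)))).differentiableAt.differentiableWithinAt
    · intro t ht
      rw [interior_Ici] at ht
      have ht0 : 0 < t := lt_trans ha (Set.mem_Ioi.mp ht)
      rw [(hf t ht0.ne').deriv]
      apply div_nonneg _ (sq_nonneg _)
      have := hsc t ht0.le
      linarith
  have := hmono (Set.self_mem_Ici) (Set.mem_Ici.mpr hab) hab
  simp only at this
  rw [div_le_div_iff₀ ha hb] at this
  linarith

/-- `x ↦ x⁹ e^{-5x}` is non-increasing on `[9/5, ∞)` (via `(1+t)⁹ ≤ e^{9t}`). -/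
theorem pow9_exp_anti {a b : ℝ} (ha : 9 / 5 ≤ a) (hab : a ≤ b) :
    b ^ 9 * Real.exp (-b) ^ 5 ≤ a ^ 9 * Real.exp (-a) ^ 5 := by
  have ha0 : 0 < a := by linarith
  set t : ℝ := (b - a) / a with htdef
  have ht0 : 0 ≤ t := div_nonneg (by linarith) ha0.le
  have hb : b = a * (1 + t) := by rw [htdef]; field_simp; ring
  have h1 : (1 + t) ≤ Real.exp t := by linarith [Real.add_one_le_exp t]
  have h9 : (1 + t) ^ 9 ≤ Real.exp t ^ 9 := pow_le_pow_left₀ (by linarith) h1 9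
  have hE9 : Real.exp t ^ 9 = Real.exp (9 * t) := by rw [← Real.exp_nat_mul]; norm_num
  -- `e^{-b}^5 = e^{-a}^5 · e^{-5 a t}` and `9t ≤ 5 a t`
  have hEb : Real.exp (-b) ^ 5 = Real.exp (-a) ^ 5 * Real.exp (-(5 * a * t)) := by
    rw [← Real.exp_nat_mul, ← Real.exp_nat_mul, ← Real.exp_add]; congr 1; rw [hb]; push_cast; ring
  have hcmp : Real.exp (9 * t) * Real.exp (-(5 * a * t)) ≤ 1 := by
    rw [← Real.exp_add, ← Real.exp_zero]; apply Real.exp_le_exp.mpr; nlinarith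
  have hEa := Real.exp_pos (-a)
  have hEa5 : 0 < Real.exp (-a) ^ 5 := by positivity
  rw [hEb, hb, mul_pow]
  have : (1 + t) ^ 9 * Real.exp (-(5 * a * t)) ≤ 1 := by
    calc (1 + t) ^ 9 * Real.exp (-(5 * a * t)) ≤ Real.exp t ^ 9 * Real.exp (-(5 * a * t)) :=
          mul_le_mul_of_nonneg_right h9 (Real.exp_pos _).le
      _ ≤ 1 := by rw [hE9]; exact hcmp
  have ha9 : 0 < a ^ 9 := by positivity
  calc a ^ 9 * (1 + t) ^ 9 * (Real.exp (-a) ^ 5 * Real.exp (-(5 * a * t)))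
      = a ^ 9 * Real.exp (-a) ^ 5 * ((1 + t) ^ 9 * Real.exp (-(5 * a * t))) := by ring
    _ ≤ a ^ 9 * Real.exp (-a) ^ 5 * 1 := mul_le_mul_of_nonneg_left this (by positivity)
    _ = a ^ 9 * Real.exp (-a) ^ 5 := by ring

/-- Monotonicity of the even bracket in its three scalar inputs (own lemma: `g₊` may be negative, so `F_mono` does not apply). -/
theorem bracket_mono {g G e E m M : ℝ} (hgG : g ≤ G) (hG : 0 ≤ G) (heE : e ≤ E) (hE : 0 ≤ E) (hM : 1 < M)
    (hMm : M ≤ m) :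
    1 + g * ((m + 1) / (m - 1)) + 2 * e / (m - 1) ≤ 1 + G * ((M + 1) / (M - 1)) + 2 * E / (M - 1) := by
  have hm1 : 0 < m - 1 := by linarith
  have hM1 : 0 < M - 1 := by linarith
  have hr : 0 ≤ (m + 1) / (m - 1) := div_nonneg (by linarith) hm1.le
  have hrR : (m + 1) / (m - 1) ≤ (M + 1) / (M - 1) := by
    rw [div_le_div_iff₀ hm1 hM1]; nlinarith
  have h1 : g * ((m + 1) / (m - 1)) ≤ G * ((m + 1) / (m - 1)) := mul_le_mul_of_nonneg_right hgG hr
  have h2 : G * ((m + 1) / (m - 1)) ≤ G * ((M + 1) / (M - 1)) := mul_le_mul_of_nonneg_left hrR hG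
  have h3 : 2 * e / (m - 1) ≤ 2 * E / (m - 1) := div_le_div_of_nonneg_right (by linarith) hm1.le
  have h4 : 2 * E / (m - 1) ≤ 2 * E / (M - 1) := div_le_div_of_nonneg_left (by linarith) hM1 (by linarith)
  linarith

/-! ## A.6 Facts about `R4 = 1000^{1/2}` and `y = Ra^{1/12}` -/

/-- `0 < R4` (`R4 = √1000`). -/
theorem R4_pos : 0 < R4 := by unfold R4; positivity
/-- `R4² = 1000`. -/
theorem R4_sq : R4 ^ 2 = 1000 := by unfold R4; rw [Real.sq_sqrt]; norm_num
/-- `R4⁴ = 10⁶`. -/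
theorem R4_pow4 : R4 ^ 4 = 10 ^ 6 := by
  have : R4 ^ 4 = (R4 ^ 2) ^ 2 := by ring
  rw [this, R4_sq]; norm_num
/-- `R4 ≤ y³` when `y > 0` and `y² ≥ 10` (i.e. `Ra = y¹² ≥ 10⁶`). -/
theorem R4_le_cube {y : ℝ} (hy : 0 < y) (hy2 : 10 ≤ y ^ 2) : R4 ≤ y ^ 3 := by
  have h6 : (1000:ℝ) ≤ (y ^ 3) ^ 2 := by
    have : (y ^ 3) ^ 2 = (y ^ 2) ^ 3 := by ring
    rw [this]; nlinarith [pow_le_pow_left₀ (by norm_num : (0:ℝ) ≤ 10) hy2 3]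
  calc R4 = Real.sqrt 1000 := rfl
    _ ≤ Real.sqrt ((y ^ 3) ^ 2) := Real.sqrt_le_sqrt h6
    _ = y ^ 3 := Real.sqrt_sq (by positivity)

/-! ## A.7 Corner monotonicity (`κ ≥ κ_I`, `10κ ≤ κ_I y²`): 5th-power comparisons -/

/-- `k e^{-k} κ² ≤ k_c e^{-k_c} κ_I²` along the corner region. -/
theorem kexp_edge {κI κ y : ℝ} (hκI : 0 < κI) (hκ : κI ≤ κ) (hy : 0 < y) (hyR : R4 ≤ y ^ 3)
    (hkc : 9 / 5 ≤ κI * R4) (hedge : 10 * κ ≤ κI * y ^ 2) :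
    (κ * y ^ 3) * Real.exp (-(κ * y ^ 3)) * κ ^ 2 ≤ (κI * R4) * Real.exp (-(κI * R4)) * κI ^ 2 := by
  have hκ0 : 0 < κ := lt_of_lt_of_le hκI hκ
  set k : ℝ := κ * y ^ 3 with hkdef
  set kc : ℝ := κI * R4 with hkcdef
  have hkck : kc ≤ k := by rw [hkdef, hkcdef]; exact mul_le_mul hκ hyR R4_pos.le hκ0.le
  have hk0 : 0 < k := by positivity
  have hL : 0 ≤ k * Real.exp (-k) * κ ^ 2 := by positivity
  have hR : 0 ≤ kc * Real.exp (-kc) * κI ^ 2 := by positivity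
  refine le_of_pow_le_pow_left₀ (by norm_num : (5:ℕ) ≠ 0) hR ?_
  have h6 : (10 * κ) ^ 6 ≤ (κI * y ^ 2) ^ 6 := pow_le_pow_left₀ (by positivity) hedge 6
  have h10 : κ ^ 10 ≤ k ^ 4 * κI ^ 6 / 10 ^ 6 := by
    rw [hkdef, le_div_iff₀ (by norm_num : (0:ℝ) < 10 ^ 6)]
    have hκ4 : 0 ≤ κ ^ 4 := by positivity
    nlinarith [mul_le_mul_of_nonneg_left h6 hκ4]
  have hexp : k ^ 9 * Real.exp (-k) ^ 5 ≤ kc ^ 9 * Real.exp (-kc) ^ 5 := pow9_exp_anti hkc hkck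
  calc (k * Real.exp (-k) * κ ^ 2) ^ 5 = k ^ 5 * Real.exp (-k) ^ 5 * κ ^ 10 := by ring
    _ ≤ k ^ 5 * Real.exp (-k) ^ 5 * (k ^ 4 * κI ^ 6 / 10 ^ 6) :=
        mul_le_mul_of_nonneg_left h10 (by positivity)
    _ = k ^ 9 * Real.exp (-k) ^ 5 * (κI ^ 6 / 10 ^ 6) := by ring
    _ ≤ kc ^ 9 * Real.exp (-kc) ^ 5 * (κI ^ 6 / 10 ^ 6) := mul_le_mul_of_nonneg_right hexp (by positivity)
    _ = (kc * Real.exp (-kc) * κI ^ 2) ^ 5 * (R4 ^ 4 / 10 ^ 6) := by rw [hkcdef]; ring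
    _ = (kc * Real.exp (-kc) * κI ^ 2) ^ 5 := by rw [R4_pow4]; ring

/-- `κ²/sinh k ≤ κ_I²/sinh k_c` along the corner region. -/
theorem sinh_edge {κI κ y : ℝ} (hκI : 0 < κI) (hκ : κI ≤ κ) (hy : 0 < y) (hyR : R4 ≤ y ^ 3)
    (hedge : 10 * κ ≤ κI * y ^ 2) :
    κ ^ 2 / Real.sinh (κ * y ^ 3) ≤ κI ^ 2 / Real.sinh (κI * R4) := by
  have hκ0 : 0 < κ := lt_of_lt_of_le hκI hκ
  set k : ℝ := κ * y ^ 3 with hkdef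
  set kc : ℝ := κI * R4 with hkcdef
  have hkc0 : 0 < kc := by rw [hkcdef]; exact mul_pos hκI R4_pos
  have hkck : kc ≤ k := by rw [hkdef, hkcdef]; exact mul_le_mul hκ hyR R4_pos.le hκ0.le
  have hk0 : 0 < k := by positivity
  have hsk : 0 < Real.sinh k := Real.sinh_pos_iff.mpr hk0
  have hskc : 0 < Real.sinh kc := Real.sinh_pos_iff.mpr hkc0
  have hss : Real.sinh kc ≤ Real.sinh k := Real.sinh_le_sinh.mpr hkck
  have hL : 0 ≤ κ ^ 2 / Real.sinh k := by positivity
  have hR : 0 ≤ κI ^ 2 / Real.sinh kc := by positivity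
  refine le_of_pow_le_pow_left₀ (by norm_num : (5:ℕ) ≠ 0) hR ?_
  have h6 : (10 * κ) ^ 6 ≤ (κI * y ^ 2) ^ 6 := pow_le_pow_left₀ (by positivity) hedge 6
  have h10 : κ ^ 10 ≤ k ^ 4 * κI ^ 6 / 10 ^ 6 := by
    rw [hkdef, le_div_iff₀ (by norm_num : (0:ℝ) < 10 ^ 6)]
    have hκ4 : 0 ≤ κ ^ 4 := by positivity
    nlinarith [mul_le_mul_of_nonneg_left h6 hκ4]
  -- `k⁴ sinh⁵ kc ≤ kc⁴ sinh⁵ k`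
  have hms : k * Real.sinh kc ≤ kc * Real.sinh k := mul_sinh_le hkc0 hkck
  have h4 : (k * Real.sinh kc) ^ 4 ≤ (kc * Real.sinh k) ^ 4 := pow_le_pow_left₀ (by positivity) hms 4
  have h45 : k ^ 4 * Real.sinh kc ^ 5 ≤ kc ^ 4 * Real.sinh k ^ 5 := by
    calc k ^ 4 * Real.sinh kc ^ 5 = (k * Real.sinh kc) ^ 4 * Real.sinh kc := by ring
      _ ≤ (kc * Real.sinh k) ^ 4 * Real.sinh k := mul_le_mul h4 hss hskc.le (by positivity)
      _ = kc ^ 4 * Real.sinh k ^ 5 := by ring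
  have hkey : k ^ 4 / Real.sinh k ^ 5 ≤ kc ^ 4 / Real.sinh kc ^ 5 := by
    rw [div_le_div_iff₀ (by positivity) (by positivity)]; exact h45
  calc (κ ^ 2 / Real.sinh k) ^ 5 = κ ^ 10 / Real.sinh k ^ 5 := by ring
    _ ≤ (k ^ 4 * κI ^ 6 / 10 ^ 6) / Real.sinh k ^ 5 := div_le_div_of_nonneg_right h10 (by positivity)
    _ = k ^ 4 / Real.sinh k ^ 5 * (κI ^ 6 / 10 ^ 6) := by ring
    _ ≤ kc ^ 4 / Real.sinh kc ^ 5 * (κI ^ 6 / 10 ^ 6) := mul_le_mul_of_nonneg_right hkey (by positivity)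
    _ = (κI ^ 2 / Real.sinh kc) ^ 5 * (R4 ^ 4 / 10 ^ 6) := by rw [hkcdef]; ring
    _ = (κI ^ 2 / Real.sinh kc) ^ 5 := by rw [R4_pow4]; ring

/-- The corner bracket bound: with `m̃ = √(1+c/κ²)`, `g ≤ 2ke^{-k}`, `e ≤ 2/sinh k`, `k = κ y³ ≥ k_c = κ_I R4`,
`1 + g(m̃+1)/(m̃−1) + 2e/(m̃−1) ≤ 1/F_edge`. -/
theorem edge_bracket_le {c κI κ y g e : ℝ} (hc : 0 < c) (hκI : 0 < κI) (hκ : κI ≤ κ) (hy : 0 < y)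
    (hyR : R4 ≤ y ^ 3) (hkc : 9 / 5 ≤ κI * R4) (hedge : 10 * κ ≤ κI * y ^ 2)
    (hg : g ≤ 2 * (κ * y ^ 3) * Real.exp (-(κ * y ^ 3))) (he : e ≤ 2 / Real.sinh (κ * y ^ 3)) :
    1 + g * ((Real.sqrt (1 + c / κ ^ 2) + 1) / (Real.sqrt (1 + c / κ ^ 2) - 1))
        + 2 * e / (Real.sqrt (1 + c / κ ^ 2) - 1)
      ≤ 1 + 2 * Real.exp (-(κI * R4)) * (κI * R4) * (Real.sqrt (1 + c / κI ^ 2) + 1) ^ 2 * κI ^ 2 / c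
          + 4 * (Real.sqrt (1 + c / κI ^ 2) + 1) * κI ^ 2 / (c * Real.sinh (κI * R4)) := by
  have hκ0 : 0 < κ := lt_of_lt_of_le hκI hκ
  set m : ℝ := Real.sqrt (1 + c / κ ^ 2) with hmdef
  set mI : ℝ := Real.sqrt (1 + c / κI ^ 2) with hmIdef
  set k : ℝ := κ * y ^ 3 with hkdef
  set kc : ℝ := κI * R4 with hkcdef
  have hkc0 : 0 < kc := by positivity
  have hk0 : 0 < k := by positivity
  have hx : 0 < c / κ ^ 2 := by positivity
  have hm1 : 1 < m := by
    have h1 : (1:ℝ) ^ 2 < 1 + c / κ ^ 2 := by nlinarith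
    rw [hmdef]; exact (Real.lt_sqrt zero_le_one).mpr h1
  have hm0 : 0 < m := by linarith
  have hmsq : m ^ 2 = 1 + c / κ ^ 2 := by rw [hmdef]; exact Real.sq_sqrt (by positivity)
  have hmsq' : m ^ 2 * κ ^ 2 = κ ^ 2 + c := by
    rw [hmsq, add_mul, one_mul, div_mul_cancel₀ _ (pow_ne_zero 2 hκ0.ne')]
  have h3 : (m - 1) * ((m + 1) * κ ^ 2) = c := by linear_combination hmsq'
  have hprod : (m - 1) * ((m + 1) * κ ^ 2 / c) = 1 := by
    rw [← mul_div_assoc, h3, div_self hc.ne']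
  have hinv : (m - 1)⁻¹ = (m + 1) * κ ^ 2 / c := inv_eq_of_mul_eq_one_right hprod
  -- `m ≤ mI`
  have hmmI : m ≤ mI := by
    rw [hmdef, hmIdef]; apply Real.sqrt_le_sqrt
    have : c / κ ^ 2 ≤ c / κI ^ 2 := div_le_div_of_nonneg_left hc.le (by positivity)
      (pow_le_pow_left₀ hκI.le hκ 2)
    linarith
  have hmI0 : 0 < mI := lt_of_lt_of_le hm0 hmmI
  -- the two scalar comparisons
  have T1 : k * Real.exp (-k) * κ ^ 2 ≤ kc * Real.exp (-kc) * κI ^ 2 := kexp_edge hκI hκ hy hyR hkc hedge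
  have T2 : κ ^ 2 / Real.sinh k ≤ κI ^ 2 / Real.sinh kc := sinh_edge hκI hκ hy hyR hedge
  have hsk : 0 < Real.sinh k := Real.sinh_pos_iff.mpr hk0
  have hskc : 0 < Real.sinh kc := Real.sinh_pos_iff.mpr hkc0
  -- term A
  have hA : g * ((m + 1) / (m - 1)) ≤ 2 * Real.exp (-kc) * kc * (mI + 1) ^ 2 * κI ^ 2 / c := by
    have e1 : (m + 1) / (m - 1) = (m + 1) ^ 2 * κ ^ 2 / c := by
      rw [div_eq_mul_inv (m + 1) (m - 1), hinv]; ring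
    rw [e1]
    have hfac : 0 ≤ (m + 1) ^ 2 * κ ^ 2 / c := by positivity
    calc g * ((m + 1) ^ 2 * κ ^ 2 / c) ≤ (2 * k * Real.exp (-k)) * ((m + 1) ^ 2 * κ ^ 2 / c) :=
          mul_le_mul_of_nonneg_right hg hfac
      _ = 2 * (k * Real.exp (-k) * κ ^ 2) * (m + 1) ^ 2 / c := by ring
      _ ≤ 2 * (kc * Real.exp (-kc) * κI ^ 2) * (mI + 1) ^ 2 / c := by
          apply div_le_div_of_nonneg_right _ hc.le
          apply mul_le_mul (by linarith) (pow_le_pow_left₀ (by linarith) (by linarith) 2) (by positivity)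
            (by positivity)
      _ = 2 * Real.exp (-kc) * kc * (mI + 1) ^ 2 * κI ^ 2 / c := by ring
  -- term B
  have hB : 2 * e / (m - 1) ≤ 4 * (mI + 1) * κI ^ 2 / (c * Real.sinh kc) := by
    rw [div_eq_mul_inv (2 * e) (m - 1), hinv]
    have hfac : 0 ≤ (m + 1) * κ ^ 2 / c := by positivity
    calc 2 * e * ((m + 1) * κ ^ 2 / c) ≤ 2 * (2 / Real.sinh k) * ((m + 1) * κ ^ 2 / c) :=
          mul_le_mul_of_nonneg_right (by linarith) hfac
      _ = 4 * (m + 1) * (κ ^ 2 / Real.sinh k) / c := by ring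
      _ ≤ 4 * (mI + 1) * (κI ^ 2 / Real.sinh kc) / c := by
          apply div_le_div_of_nonneg_right _ hc.le
          exact mul_le_mul (by linarith) T2 (by positivity) (by positivity)
      _ = 4 * (mI + 1) * κI ^ 2 / (c * Real.sinh kc) := by ring
  linarith

end Summit.NavierStokesRegularity.TurbBounds.FSU1.Mode
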